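import Literature.AlgebraicGeometry.Resolution.AlterationsSemiStableNodeStructure
import HarnessLib

/-!
# De Jong's alteration theorem: the Claim of 3.4 reduced to the exceptional locus (de Jong 1996, 3.4)

Topic: `Literature/AlgebraicGeometry/Resolution`. Companion to `AlterationsSemiStableNodeStructure.lean`,
which reduced the tree's leaf `DeJong1996SemiStableCodimTwoBlowup` (the Claim of de Jong 1996,
3.4 for ONE blow-up `φ : X' → X` of a codimension-2 component `T = cl{x}` of `Sing(X)`) to its
chart-dependent core `DeJong1996SemiStableCodimTwoBlowupCore`: (ii) `φ ≫ f` is a semi-stable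
curve, and (iii) `φ` maps the codimension-2 singular points of `X'` to those of `X` ("lying
above"), injectively ("at most one `T̃` above each `T'`"), the thickness dropping by `2` over
`T`. Of (iii), everything that happens OFF the exceptional locus `E = φ⁻¹(T)` is formal — there
`φ` is an isomorphism (Stacks 02OS) — and only the statements about the codimension-2 singular
points INSIDE `E` need the charts of 3.4:

> "Chart "`t₁ ≠ 0`". — Here we get
> `A[u, v, u', v']/(u - t₁u', v - t₁v', u'v' - t₁^{n₁-2} t₂^{n₂} ⋯ t_r^{n_r})`. Again the
> situation is rather clear. The "new" component `T̃` lying over `T` is given by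
> `u' = v' = t₁ = 0`, unless `n₁ = 2, 3`, then `T̃` lying over `T` does not exist. Clearly,
> `n_T` has dropped by 2." (p. 64)

Accordingly this file

* vendors `DeJong1996SemiStableCodimTwoBlowupCentre` — NAMED FACT, the Claim of 3.4 for one
  blow-up with (iii) restricted to the exceptional locus: (ii) `φ ≫ f` is a semi-stable curve;
  (iii-E) a codimension-`≤ 2` singular point `x̃` of `X'` over `T = cl{x}` lies over the generic
  point `x` of `T` ("`T̃` lying over `T`", a component of the same dimension as `T` dominating
  it) with `n(x̃) + 2 = n(x)` ("`n_T` has dropped by 2"), and there is at most one such `x̃`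
  ("the "new" component `T̃`");
* PROVES the formal part of (iii) off `E`: a blow-up of `X` in the ideal sheaf of `cl{x}`
  induces isomorphisms of stalks at the points not over `cl{x}`
  (`IsBlowup.isIso_stalkMap_of_notMem_closure`), hence preserves there membership in the
  codimension-`≤ c` singular locus (`mem_singularLocusCodimLE_iff_of_isIso_stalkMap`: regularity
  and dimension of the local ring are invariant under ring isomorphisms), and is injective on
  the complement of `E` (`IsBlowup.injOn_compl_preimage_closure`); whence
  `DeJong1996SemiStableCodimTwoBlowupCore.of_centre` — "lying above" (over `E` by (iii-E), off
  `E` by the stalk isomorphism) and "at most one" (two codimension-2 singular points with the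
  same image are both over `E`, where (iii-E) applies, or both off `E`, where `φ` is injective),
  conversely `DeJong1996SemiStableCodimTwoBlowupCentre.of_core` (the two renderings are
  equivalent: a codimension-2 singular point of `X` in `cl{x}` is `x`, by `codim(Sing(X), X) ≥ 2`)
  — and the assemblies down to `DeJong1996SemiStableCodimTwoModification`, `DeJong1996Lemma32`
  and `DeJong1996SemiStableCodimThree` from the two leaves `DeJong1996SemiStableThickness` and
  `DeJong1996SemiStableCodimTwoBlowupCentre`.

## Sources

* A. J. de Jong, *Smoothness, semi-stability and alterations*, Publ. Math. IHÉS 83 (1996) 51–93: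
  3.3–3.4 (pp. 63–64).
* The Stacks Project, Tag 02OS (a blow-up is an isomorphism away from the centre), via
  `Blowups.lean` (`IsBlowup.isIso_compl`).
-/

noncomputable section

open CategoryTheory CategoryTheory.Limits AlgebraicGeometry TopologicalSpace Topology IsLocalRing

namespace Literature.AlgebraicGeometry.Resolution

universe u

/-! ## Off the centre, a blow-up of `cl{x}` is a local isomorphism -/

section OffCentre

open Scheme.IdealSheafData

variable {X' X : Scheme.{u}} {π : X' ⟶ X} {x : X}

/-- A blow-up of `X` in the ideal sheaf of `cl{x}` induces an isomorphism of stalks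
`𝒪_{X, π x'} ≅ 𝒪_{X', x'}` at every point `x'` not over `cl{x}` (it is an isomorphism over the
open `X ∖ cl{x}`, Stacks 02OS). [folklore] -/
theorem IsBlowup.isIso_stalkMap_of_notMem_closure
    (hπ : IsBlowup π (vanishingIdeal ⟨closure ({x} : Set X), isClosed_closure⟩)) {x' : X'}
    (hx' : π x' ∉ closure ({x} : Set X)) : IsIso (π.stalkMap x') := by
  haveI : IsIso (π ∣_ centreCompl (vanishingIdeal ⟨closure ({x} : Set X), isClosed_closure⟩)) :=
    hπ.isIso_compl
  have hmem : π x' ∈ centreCompl (vanishingIdeal ⟨closure ({x} : Set X), isClosed_closure⟩) := by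
    show π x' ∈ ((vanishingIdeal ⟨closure ({x} : Set X), isClosed_closure⟩).support : Set X)ᶜ
    rw [coe_support_vanishingIdeal]
    exact hx'
  exact isIso_stalkMap_of_isIso_morphismRestrict π _ x' hmem

/-- At a point where `π` is a local isomorphism, membership in the codimension-`≤ c` singular
locus is preserved: regularity and the dimension of the local ring are invariant under the ring
isomorphism `𝒪_{X, π x'} ≅ 𝒪_{X', x'}`. [folklore] -/
theorem mem_singularLocusCodimLE_iff_of_isIso_stalkMap (π : X' ⟶ X) (x' : X')
    [IsIso (π.stalkMap x')] (c : ℕ) :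
    x' ∈ Scheme.singularLocusCodimLE X' c ↔ π x' ∈ Scheme.singularLocusCodimLE X c := by
  let e : X.presheaf.stalk (π x') ≃+* X'.presheaf.stalk x' :=
    (asIso (π.stalkMap x')).commRingCatIsoToRingEquiv
  simp only [Scheme.mem_singularLocusCodimLE]
  rw [ringKrullDim_eq_of_ringEquiv e]
  exact and_congr_left' (not_congr
    ⟨fun h => IsRegularLocalRing.of_ringEquiv e.symm, fun h => IsRegularLocalRing.of_ringEquiv e⟩)

/-- A blow-up of `X` in the ideal sheaf of `cl{x}` is injective on the complement of the
exceptional locus `π⁻¹(cl{x})` (it is an isomorphism over `X ∖ cl{x}`). [folklore] -/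
theorem IsBlowup.injOn_compl_preimage_closure
    (hπ : IsBlowup π (vanishingIdeal ⟨closure ({x} : Set X), isClosed_closure⟩)) :
    Set.InjOn π (π ⁻¹' (closure ({x} : Set X))ᶜ) := by
  set U : X.Opens := centreCompl (vanishingIdeal ⟨closure ({x} : Set X), isClosed_closure⟩)
    with hU
  haveI : IsIso (π ∣_ U) := hπ.isIso_compl
  have hUeq : (U : Set X) = (closure ({x} : Set X))ᶜ := by
    show ((vanishingIdeal ⟨closure ({x} : Set X), isClosed_closure⟩).support : Set X)ᶜ = _
    rw [coe_support_vanishingIdeal]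
    rfl
  intro a ha b hb hab
  have ha' : a ∈ π ⁻¹ᵁ U := by
    show π a ∈ (U : Set X)
    rw [hUeq]
    exact ha
  have hb' : b ∈ π ⁻¹ᵁ U := by
    show π b ∈ (U : Set X)
    rw [hUeq]
    exact hb
  have heq : (π ∣_ U) ⟨a, ha'⟩ = (π ∣_ U) ⟨b, hb'⟩ := by
    apply Subtype.ext
    rw [morphismRestrict_base_coe, morphismRestrict_base_coe]
    exact hab
  exact congrArg Subtype.val ((π ∣_ U).isOpenEmbedding.injective heq)

end OffCentre

/-! ## The Claim of 3.4 with (iii) restricted to the exceptional locus -/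

open Scheme.IdealSheafData in
/-- NAMED FACT — **de Jong 1996, 3.4, the Claim for one blow-up, with (iii) read on the
exceptional locus only.** Setting 3.1, `T` an irreducible component of `Sing(X)` of codimension
`2`, `φ : X' → X` the blowing up of `X` in the ideal sheaf of `T`: "(ii) `X'` is a semi-stable
curve over `S` … (iii) the invariant `n_T` has dropped … There exists at most one such
irreducible component `T̃ ⊂ Sing(X')` lying above `T'`; … `T' = T` in which case we have
`n_T̃ = n_T - 2`. … Chart "`t₁ ≠ 0`". — Here we get
`A[u, v, u', v']/(u - t₁u', v - t₁v', u'v' - t₁^{n₁-2} t₂^{n₂} ⋯ t_r^{n_r})`. Again the situation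
is rather clear. The "new" component `T̃` lying over `T` is given by `u' = v' = t₁ = 0`, unless
`n₁ = 2, 3`, then `T̃` lying over `T` does not exist. Clearly, `n_T` has dropped by 2." Rendered
for the curve `f : X → Y` of a pair in Situation 4.23 over an algebraically closed `k`, the
generic point `x` of `T` (a non-regular point with `dim 𝒪_{X,x} ≤ 2`) and ANY blowing up
`π : X' → X` of `X` in the ideal sheaf of the reduced closed subscheme `cl{x}`: (ii) `π ≫ f` is a
semi-stable curve (2.21); (iii-E) every codimension-`≤ 2` singular point `x̃` of `X'` over
`cl{x}` (the generic point of a codimension-2 component `T̃` of `Sing(X')` inside the exceptional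
locus `E = π⁻¹(T)`) lies over `x` itself (`T̃` lies ABOVE `T`: it dominates `T`) and has
thickness `n(x̃) + 2 = n(x)` (`Scheme.Hom.nodeThickness`), and there is at most one such `x̃`.
The remaining clauses of (iii) — "lying above" and "at most one" for the components not inside
`E`, where `π` is a local isomorphism — are PROVED below
(`DeJong1996SemiStableCodimTwoBlowupCore.of_centre`). Users take
`(h : DeJong1996SemiStableCodimTwoBlowupCentre)`; it is a node to decompose further (the three
charts of the blow-up of `Spec A'[u, v]/(Q - t₁^{n₁} ⋯ t_r^{n_r})` in `(u, v, t₁)`; "completion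
and blowing up commute"; 2.21 for `X'` via its geometric fibres).
[cite: DeJong1996, 3.4 Claim (ii)–(iii), pp. 63–64] -/
def DeJong1996SemiStableCodimTwoBlowupCentre : Prop :=
  ∀ (k : Type u) [Field k] [IsAlgClosed k] (X Y : Scheme.{u}) (f : X ⟶ Y)
    (g : Y ⟶ Spec (.of k)) (D : Set Y) (n : ℕ) (τ : Fin n → (Y ⟶ X)),
    DeJong1996.SemiStablePair f g D τ →
      ∀ x ∈ Scheme.singularLocusCodimLE X 2,
        ∀ (X' : Scheme.{u}) (π : X' ⟶ X),
          IsBlowup π (vanishingIdeal ⟨closure {x}, isClosed_closure⟩) →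
            IsSemiStableCurve (π ≫ f) ∧
            (∀ x' ∈ Scheme.singularLocusCodimLE X' 2, π x' ∈ closure ({x} : Set X) →
              π x' = x ∧
                Scheme.Hom.nodeThickness (π ≫ f) x' + 2 = Scheme.Hom.nodeThickness f x) ∧
            (∀ x' ∈ Scheme.singularLocusCodimLE X' 2, ∀ x'' ∈ Scheme.singularLocusCodimLE X' 2,
              π x' ∈ closure ({x} : Set X) → π x'' ∈ closure ({x} : Set X) → x' = x'')

/-- **The chart-dependent core of the Claim of 3.4 (`DeJong1996SemiStableCodimTwoBlowupCore`)
from its restriction to the exceptional locus** (`DeJong1996SemiStableCodimTwoBlowupCentre`):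
"lying above" — over `E` by (iii-E) (`π x̃ = x`, a codimension-2 singular point), off `E`
because `π` is a local isomorphism there (`mem_singularLocusCodimLE_iff_of_isIso_stalkMap`);
"at most one" — two codimension-`≤ 2` singular points of `X'` with the same image are either
both over `cl{x}`, where (iii-E) gives equality, or both off it, where `π` is injective
(`IsBlowup.injOn_compl_preimage_closure`); the drop `n(x̃) + 2 = n(x)` for `π x̃ = x ∈ cl{x}` is
(iii-E). [cite: DeJong1996, 3.4 Claim (iii), pp. 63–64] -/
theorem DeJong1996SemiStableCodimTwoBlowupCore.of_centre
    (h : DeJong1996SemiStableCodimTwoBlowupCentre.{u}) :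
    DeJong1996SemiStableCodimTwoBlowupCore.{u} := by
  intro k _ _ X Y f g D n τ hS x hx X' π hπ
  obtain ⟨hss, hover, huniq⟩ := h k X Y f g D n τ hS x hx X' π hπ
  refine ⟨hss, fun x' hx' => ?_, ?_, fun x' hx' hπx' => (hover x' hx' ?_).2⟩
  · -- "lying above"
    by_cases hE : π x' ∈ closure ({x} : Set X)
    · rw [(hover x' hx' hE).1]
      exact hx
    · haveI := hπ.isIso_stalkMap_of_notMem_closure hE
      exact (mem_singularLocusCodimLE_iff_of_isIso_stalkMap π x' 2).mp hx'
  · -- "at most one"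
    intro a ha b hb hab
    by_cases haE : π a ∈ closure ({x} : Set X)
    · have hbE : π b ∈ closure ({x} : Set X) := by rwa [hab] at haE
      exact huniq a ha b hb haE hbE
    · have hbE : π b ∉ closure ({x} : Set X) := by rwa [hab] at haE
      exact hπ.injOn_compl_preimage_closure haE hbE hab
  · -- the point over `x` lies over `cl{x}`
    rw [hπx']
    exact subset_closure (Set.mem_singleton x)

/-- Sanity of the cut: conversely the core of the Claim gives its restriction to the
exceptional locus — a codimension-`≤ 2` singular point of `X` in `cl{x}` is `x` itself (a
proper specialization of `x` has a local ring of dimension `> 2`, by `codim(Sing(X), X) ≥ 2`),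
so "lying above" forces `π x̃ = x` over `cl{x}` and "at most one" gives the uniqueness. Hence the
two renderings are equivalent. [folklore] -/
theorem DeJong1996SemiStableCodimTwoBlowupCentre.of_core
    (h : DeJong1996SemiStableCodimTwoBlowupCore.{u}) :
    DeJong1996SemiStableCodimTwoBlowupCentre.{u} := by
  intro k _ _ X Y f g D n τ hS x hx X' π hπ
  obtain ⟨hss, hmaps, hinj, hdrop⟩ := h k X Y f g D n τ hS x hx X' π hπ
  haveI := hS.isIntegral
  haveI := hS.isNoetherian
  -- a codimension-`≤ 2` singular point of `X` in `cl{x}` is `x`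
  have key : ∀ x' ∈ Scheme.singularLocusCodimLE X' 2, π x' ∈ closure ({x} : Set X) →
      π x' = x := by
    intro x' hx' hE
    by_contra hne
    have hspec : x ⤳ π x' := specializes_iff_mem_closure.mpr hE
    have hlt := ringKrullDim_stalk_lt_of_specializes hspec (Ne.symm hne)
    have h2 : (2 : WithBot ℕ∞) ≤ ringKrullDim (X.presheaf.stalk x) :=
      DeJong1996SemiStableSingCodimTwo_holds k X Y f g D n τ hS x hx.1
    exact absurd (lt_of_le_of_lt h2 (lt_of_lt_of_le hlt (hmaps hx').2)) (lt_irrefl _)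
  refine ⟨hss, fun x' hx' hE => ⟨key x' hx' hE, hdrop x' hx' (key x' hx' hE)⟩,
    fun a ha b hb haE hbE => hinj ha hb ?_⟩
  rw [key a ha haE, key b hb hbE]

/-! ## The assemblies -/

/-- **`DeJong1996SemiStableCodimTwoModification` from the two leaves `DeJong1996SemiStableThickness`
(3.4: `2 ≤ n_T < ∞`) and `DeJong1996SemiStableCodimTwoBlowupCentre` (the Claim of 3.4 for one
blow-up: (ii), and (iii) on the exceptional locus).** [cite: DeJong1996, 3.3–3.4, pp. 63–64] -/
theorem DeJong1996SemiStableCodimTwoModification.of_thickness_of_centre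
    (h2 : DeJong1996SemiStableThickness.{u}) (hE : DeJong1996SemiStableCodimTwoBlowupCentre.{u}) :
    DeJong1996SemiStableCodimTwoModification.{u} :=
  DeJong1996SemiStableCodimTwoModification.of_thickness_of_core h2
    (DeJong1996SemiStableCodimTwoBlowupCore.of_centre hE)

/-- `DeJong1996SemiStableCodimTwoModification` from 3.3 at `η_T`
(`DeJong1996NodeLocalStructureCodimTwo`) and the Claim of 3.4 on the exceptional locus
(`DeJong1996SemiStableCodimTwoBlowupCentre`). [cite: DeJong1996, 3.3–3.4, pp. 63–64] -/
theorem DeJong1996SemiStableCodimTwoModification.of_nodeLocalStructure_of_centre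
    (hL : DeJong1996NodeLocalStructureCodimTwo.{u})
    (hE : DeJong1996SemiStableCodimTwoBlowupCentre.{u}) :
    DeJong1996SemiStableCodimTwoModification.{u} :=
  DeJong1996SemiStableCodimTwoModification.of_thickness_of_centre
    (DeJong1996SemiStableThickness.of_nodeLocalStructureCodimTwo hL) hE

/-- **de Jong 1996, Lemma 3.2** (`DeJong1996Lemma32`) from the two leaves
`DeJong1996SemiStableThickness` and `DeJong1996SemiStableCodimTwoBlowupCentre`.
[cite: DeJong1996, 3.2–3.4, pp. 62–64] -/
theorem DeJong1996Lemma32.of_thickness_of_centre (h2 : DeJong1996SemiStableThickness.{u})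
    (hE : DeJong1996SemiStableCodimTwoBlowupCentre.{u}) : DeJong1996Lemma32.{u} :=
  DeJong1996Lemma32.of_codimTwoModification
    (DeJong1996SemiStableCodimTwoModification.of_thickness_of_centre h2 hE)

/-- `DeJong1996SemiStableCodimThree` (4.24, first sentence) from the two leaves
`DeJong1996SemiStableThickness` and `DeJong1996SemiStableCodimTwoBlowupCentre`.
[cite: DeJong1996, 3.2–3.4 and 4.24, pp. 62–64, 75] -/
theorem DeJong1996SemiStableCodimThree.of_thickness_of_centre (h2 : DeJong1996SemiStableThickness.{u})
    (hE : DeJong1996SemiStableCodimTwoBlowupCentre.{u}) : DeJong1996SemiStableCodimThree.{u} :=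
  DeJong1996SemiStableCodimThree.of_codimTwoModification
    (DeJong1996SemiStableCodimTwoModification.of_thickness_of_centre h2 hE)

end Literature.AlgebraicGeometry.Resolution

end
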